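import Summits.QuantumFields.BalabanUV.Beta.D1BFx.ProjectorKernelIdentities
import Summits.QuantumFields.BalabanUV.Beta.D1BFx.PeriodisedKernels

/-!
# `BalabanUV.Beta.D1BFx.PeriodisedProjector` — road «BF-x» for binder row D1, slot (K), debt X₁a, brick **Q3b part 2** of `X1-SPEC.md`:
# ON EVERY TORUS `(ℤ/s)⁴` WITH `(m+1) ∣ s`, THE PERIODISED ROAD PROJECTOR `P̂ = periodise₂ s Pker` IS SYMMETRIC, IDEMPOTENT, FIXES
# `range(Ĝ′Q̂′*)`, AND **`1 − P̂` IS THE ORTHOGONAL PROJECTOR ONTO `Δ̂ N(Q̂′)`** (the block-mean-free gauge modes) — by an4's product rule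
# and Lemma 2.2.2 applied to the ℤ⁴ kernel identities of `D1BFx/ProjectorKernelIdentities`, with NO dimension count

HONEST FRAMING (cell contract, verbatim): «discharging `BetaPertH` makes Bałaban's UV stability UNCONDITIONAL — a real constructive-QFT
result; it is NOT the continuum limit and NOT the Clay problem.»  HONEST DEPENDENCY (verbatim): «continuum YM on T⁴ ⇐ BetaPertH ∧ nine
spine estimates (0/9 proved); BetaPertH ⇐ (D1) ∧ (D4) ∧ CAP+tail; G-an2-4 gates asym, D1 and NE2/3/4.»  THIS MODULE DISCHARGES NOTHING of
D1 / BetaPertH: [folklore] finite-dimensional linear algebra on the torus, every input BY NAME — an4's `Beta/EntrywiseVolumeLimit`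
(`periodise₂_compKer`, `lemma222_periodic`, `periodise₂_add/const_mul`), this lineage's `ProjectorKernelIdentities` (`tsum_Pker_mul_gq`,
`tsum_Pker_mul_lapKer`, `lapRow`), `RProjectorRange.tsum_Pker_mul_Pker`, `RProjector.Pker_symm`, `B5Hk103ScalarZd.sum_AX_mul_Gk`, and part 1
`PeriodisedKernels` (periodicity, row bounds, `periodise₂_symm`, `tblk`, `periodise₂_sameBlk`, `sum_periodise₂_mul_eq_zero_of_blockMeanFree`).
Six data `def`s with bodies ([our object]: the torus matrices `Phat`, `Lhat`, `Shat`, `Ghat`, `Gshat`, `AXhat`); nothing is cited; 0 sorry.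
NOT summit progress; NOT BetaPertH, NOT continuum, NOT Clay.

ABSOLUTE RULE (cell, verbatim): «No internally-minted statement may enter as a cited fact. Every hypothesis is either kernel-proved in this
package or a verbatim quotation of a PUBLISHED theorem with page reference. The manuscript(s) under audit are NOT citable for their own
disputed steps — they are the thing under adjudication; programme-internal (2001/route/tribunal) claims are never citable.»

WHY (`HOME/b2b-balaban-beta-d1-p2/X1-SPEC.md` v1 §1 brick Q3b, owner claim ρ-g5-6).  Brick Q3c compares an5's torus gauge projector
`B5Value126.PcT` (B5 (1.26)/(1.70) form; CONTEXT ONLY) with `P̂` through the CHARACTERISATION proved here: NE2's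
`T4Continuum/Support/VariationalVectorGaugeSliceB5` already shows that on `1^⊥` an5's `1 − PcT` is the orthogonal projection onto the gauge
modes `div D (ker Q′)`; this file shows that `1 − P̂` is the orthogonal projection onto `L̂(N̂)` — `L̂ = periodise₂ s (−Δ)`, `N̂` = torus
vectors with vanishing torus block sums — so the two coincide on gradients once Q2 identifies the vocabularies.  The proof avoids any
dimension count or `ker Δ̂ = constants`: every vector `v` has `(1 − P̂)v = L̂λ` with the EXPLICIT block-mean-free `λ := (m+1)²·Ĝ′(1 − P̂)v`,
because `Ŝ·Ĝ′·(1 − P̂) = (Ĝ′Ŝ)ᵀ(1 − P̂) = ((1 − P̂)·Ĝ′Q̂′*Q̂′)ᵀ = 0` and the periodised tower equation `((m+1)²L̂ + a(m+1)⁻⁴Ŝ)·Ĝ′ = 1`.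

CONTENT (d = 4, pv23 block side `m+1`, `a > 0`, torus `Beta.Site 4 s`, `hs : s = (m+1)·p`; all [folklore] / [our object]).
* §1 the six torus matrices and their entry formulas; `AXhat_eq` (`ÂX = (m+1)²•L̂ + (a/(m+1)⁴)•Ŝ`); `Shat_mulVec_apply` (torus block sums).
* §2 the periodised kernel identities: `Phat_mul_Phat`, `Phat_transpose`, `Phat_mul_Gshat` (`P̂·Ĝs = Ĝs`), `Phat_mul_Lhat_apply` + `Phat_Lhat_mulVec`
  (`P̂L̂λ = 0` for block-mean-free `λ`), `Gshat_eq` (`Ĝs = Ĝ′·Ŝ`), `Ghat_transpose`, `Shat_transpose`, `Ghat_mul_AXhat`/`AXhat_mul_Ghat` (Lemma 2.2.2).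
* §3 consequences: `Ghat_Lhat_mulVec` (`Ĝ′L̂λ = (m+1)⁻²λ`), `Lhat_Ghat_mulVec`, `Shat_Ghat_Rhat` (`Ŝ·Ĝ′·(1 − P̂) = 0`), **`Rhat_mulVec_eq_Lhat`** (the explicit
  `λ`), `Rhat_Lhat_mulVec` (`(1 − P̂)L̂λ = L̂λ`), `Rhat_mul_Gshat` (`(1 − P̂)Ĝs = 0`), `Rhat_mul_Rhat`, `Rhat_transpose`, and the orthogonality
  `Gshat_mulVec_dot_Lhat_mulVec` (`⟨Ĝsω, L̂λ⟩ = 0`); packaged: **`Rhat_mulVec_eq_self_iff`** (`(1 − P̂)v = v ↔ ∃ block-mean-free λ, v = L̂λ`).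
Unit `b2b-balaban-beta-d1-p2` (road owner, gen 5).
-/

namespace Summit.QuantumFields.BalabanUV.Beta.D1BFx.PeriodisedProjector

open Finset Matrix
open scoped BigOperators
open Literature.MathematicalPhysics.QuantumFieldTheory.Balaban1983to89
open Literature.MathematicalPhysics.QuantumFieldTheory.Balaban1983to89.Beta
open B6QGQLower276 (X side blk B mem_B lapKer sameBlk AX AX_symm lapKer_symm sameBlk_symm)
open B5Hk103ScalarZd (Gk gq sum_AX_mul_Gk tsum_AX_mul)
open Summit.QuantumFields.BalabanUV.Beta.D1BFx.RProjector (kerP Pker Pker_symm abs_Pker_le abs_kerP_le cPP deltaPP cPP_nonneg deltaPP_pos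
  cP deltaP cP_nonneg deltaP_pos)
open Summit.QuantumFields.BalabanUV.Beta.D1BFx.RProjectorRange (Gk_symm tsum_Pker_mul_Pker summable_of_blk_majorant)
open Summit.QuantumFields.BalabanUV.Beta.D1BFx.RJetProjector (kerP_translate Pker_translate)
open Summit.QuantumFields.BalabanUV.Beta.D1BFx.GhostLeg (blk_translate)
open Summit.QuantumFields.BalabanUV.Beta.D1BFx.ProjectorKernelIdentities (lapRow tsum_Pker_mul_gq tsum_Pker_mul_lapKer)
open Summit.QuantumFields.BalabanUV.Beta.D1BFx.PeriodisedKernels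

noncomputable section

variable (m : ℕ) (a : ℝ) (s : ℕ) [NeZero s]

/-! ## §1 The torus matrices -/

/-- [our object] `P̂ := periodise₂ s P` — the road's gauge projector on the torus. -/
def Phat : Matrix (Site 4 s) (Site 4 s) ℝ := Matrix.of (periodise₂ s (Pker (d := 4) m a))
/-- [our object] `L̂ := periodise₂ s (−Δ)` — the torus Laplacian (positive). -/
def Lhat : Matrix (Site 4 s) (Site 4 s) ℝ := Matrix.of (periodise₂ s (lapKer (d := 4)))
/-- [our object] `Ŝ := periodise₂ s 1[same block]` — the torus block indicator (`Q̂′*Q̂′` up to `(m+1)⁴`). -/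
def Shat : Matrix (Site 4 s) (Site 4 s) ℝ := Matrix.of (periodise₂ s (sameBlk (d := 4) m))
/-- [our object] `Ĝ′ := periodise₂ s G′` — the torus tower propagator. -/
def Ghat : Matrix (Site 4 s) (Site 4 s) ℝ := Matrix.of (periodise₂ s (Gk (d := 4) m a))
/-- [our object] `Ĝs := periodise₂ s (G′Q′*Q′)`. -/
def Gshat : Matrix (Site 4 s) (Site 4 s) ℝ := Matrix.of (periodise₂ s (gsKer m a))
/-- [our object] `ÂX := periodise₂ s Δ′_a`. -/
def AXhat : Matrix (Site 4 s) (Site 4 s) ℝ := Matrix.of (periodise₂ s (AX (d := 4) m a))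

variable {m a s}

/-- [folklore] Entries of `Phat`. -/
@[simp] theorem Phat_apply (x z : Site 4 s) : Phat m a s x z = periodise₂ s (Pker (d := 4) m a) x z := rfl
/-- [folklore] Entries of `Lhat`. -/
@[simp] theorem Lhat_apply (x z : Site 4 s) : Lhat s x z = periodise₂ s (lapKer (d := 4)) x z := rfl
/-- [folklore] Entries of `Shat`. -/
@[simp] theorem Shat_apply (x z : Site 4 s) : Shat m s x z = periodise₂ s (sameBlk (d := 4) m) x z := rfl
/-- [folklore] Entries of `Ghat`. -/
@[simp] theorem Ghat_apply (x z : Site 4 s) : Ghat m a s x z = periodise₂ s (Gk (d := 4) m a) x z := rfl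
/-- [folklore] Entries of `Gshat`. -/
@[simp] theorem Gshat_apply (x z : Site 4 s) : Gshat m a s x z = periodise₂ s (gsKer m a) x z := rfl
/-- [folklore] Entries of `AXhat`. -/
@[simp] theorem AXhat_apply (x z : Site 4 s) : AXhat m a s x z = periodise₂ s (AX (d := 4) m a) x z := rfl

/-- [folklore] `Δ′_a = (m+1)²·(−Δ) + a(m+1)⁻⁴·1[same block]` as kernels. -/
theorem AX_eq_add : AX (d := 4) m a = (fun p q => ((m : ℝ) + 1) ^ 2 * lapKer p q) + fun p q => a / ((m : ℝ) + 1) ^ 4 * sameBlk m p q := by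
  funext p q; rfl

/-- [folklore] **`ÂX = (m+1)²•L̂ + (a/(m+1)⁴)•Ŝ`**. -/
theorem AXhat_eq : AXhat m a s = (((m : ℝ) + 1) ^ 2) • Lhat s + (a / ((m : ℝ) + 1) ^ 4) • Shat m s := by
  ext x z
  simp only [AXhat_apply, Matrix.add_apply, Matrix.smul_apply, Lhat_apply, Shat_apply, smul_eq_mul]
  rw [AX_eq_add, periodise₂_add (fun p => ((rowBound_lapKer m).summable p).mul_left _)
    (fun p => ((rowBound_sameBlk m).summable p).mul_left _), periodise₂_const_mul, periodise₂_const_mul]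

/-- [folklore] **TORUS BLOCK SUMS**: `(Ŝλ)(z₀) = Σ_{z : tblk z = tblk z₀} λ(z)` (`s = (m+1)·p`). -/
theorem Shat_mulVec_apply {p : ℕ} (hs : s = (m + 1) * p) (lam : Site 4 s → ℝ) (z₀ : Site 4 s) :
    (Shat m s *ᵥ lam) z₀ = ∑ z ∈ Finset.univ.filter (fun z => tblk m z = tblk m z₀), lam z := by
  simp only [Matrix.mulVec, dotProduct, Shat_apply, periodise₂_sameBlk m hs]
  rw [Finset.sum_filter]
  refine Finset.sum_congr rfl fun z _ => ?_
  by_cases h : tblk m z = tblk m z₀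
  · simp [h]
  · simp [h, Ne.symm h]

/-- [folklore] `Ŝλ = 0` iff all torus block sums of `λ` vanish. -/
theorem Shat_mulVec_eq_zero_iff {p : ℕ} (hs : s = (m + 1) * p) (lam : Site 4 s → ℝ) :
    Shat m s *ᵥ lam = 0 ↔ ∀ z₀ : Site 4 s, ∑ z ∈ Finset.univ.filter (fun z => tblk m z = tblk m z₀), lam z = 0 := by
  constructor
  · intro h z₀; rw [← Shat_mulVec_apply hs]; exact congr_fun h z₀
  · intro h; funext z₀; rw [Shat_mulVec_apply hs]; exact h z₀

/-! ## §2 The periodised kernel identities -/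

section Identities

variable {p : ℕ}

omit [NeZero s] in
/-- [folklore] `(m+1) ∣ s` from `s = (m+1)·p`. -/
theorem hdiv_of_hs (hs : s = (m + 1) * p) : m + 1 ∣ s := ⟨p, hs⟩

/-- [folklore] `P ∘ P = P` as kernels (`RProjectorRange.tsum_Pker_mul_Pker`). -/
theorem compKer_Pker_Pker (ha : 0 < a) : compKer (Pker (d := 4) m a) (Pker m a) = Pker m a := by
  funext p q; exact tsum_Pker_mul_Pker m ha p q

/-- [folklore] **`P̂·P̂ = P̂`**. -/
theorem Phat_mul_Phat (ha : 0 < a) (hs : s = (m + 1) * p) : Phat m a s * Phat m a s = Phat m a s := by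
  ext x z
  rw [Matrix.mul_apply]
  simp only [Phat_apply]
  rw [← periodise₂_compKer (summable_abs_row_Pker m ha) (isPeriodic₂_Pker m ha (hdiv_of_hs hs)) (rowBound_Pker m ha),
    compKer_Pker_Pker ha]

/-- [folklore] **`P̂ᵀ = P̂`**. -/
theorem Phat_transpose (ha : 0 < a) (hs : s = (m + 1) * p) : (Phat m a s)ᵀ = Phat m a s := by
  ext x z
  rw [Matrix.transpose_apply, Phat_apply, Phat_apply]
  exact (periodise₂_symm (isPeriodic₂_Pker m ha (hdiv_of_hs hs)) (fun p q => Pker_symm m ha p q) x z).symm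

/-- [folklore] `P ∘ (G′Q′*Q′) = G′Q′*Q′` as kernels (`ProjectorKernelIdentities.tsum_Pker_mul_gq`). -/
theorem compKer_Pker_gsKer (ha : 0 < a) : compKer (Pker (d := 4) m a) (gsKer m a) = gsKer m a := by
  funext p q; exact tsum_Pker_mul_gq m ha p (blk m q)

/-- [folklore] **`P̂·Ĝs = Ĝs`** — `P̂` fixes the range of `Ĝ′Q̂′*`. -/
theorem Phat_mul_Gshat (ha : 0 < a) (hs : s = (m + 1) * p) : Phat m a s * Gshat m a s = Gshat m a s := by
  ext x z
  rw [Matrix.mul_apply]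
  simp only [Phat_apply, Gshat_apply]
  rw [← periodise₂_compKer (summable_abs_row_Pker m ha) (isPeriodic₂_gsKer m ha (hdiv_of_hs hs)) (rowBound_gsKer m ha),
    compKer_Pker_gsKer ha]

/-- [folklore] `P ∘ (−Δ)` as a kernel: `(p, r) ↦ lapRow m a p (blk r)` (`ProjectorKernelIdentities.tsum_Pker_mul_lapKer`). -/
theorem compKer_Pker_lapKer (ha : 0 < a) : compKer (Pker (d := 4) m a) lapKer = fun p r => lapRow m a p (blk m r) := by
  funext p r; exact tsum_Pker_mul_lapKer m ha p r

/-- [folklore] Summing over a translated block. -/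
theorem sum_B_add (f : X 4 → ℝ) (y t : X 4) : ∑ q ∈ B m (y + t), f q = ∑ q ∈ B m y, f (q + side m • t) := by
  rw [B6QGQLower276.sum_B, B6QGQLower276.sum_B]
  refine Finset.sum_congr rfl fun z _ => ?_
  congr 1; funext μ
  simp only [B6QGQLower276.chart, Pi.add_apply, Pi.smul_apply, smul_eq_mul]; ring

/-- [folklore] Block covariance of the factored row `lapRow`. -/
theorem lapRow_translate (ha : 0 < a) (t p y : X 4) : lapRow m a (p + side m • t) (y + t) = lapRow m a p y := by
  simp only [lapRow, kerP_translate m ha, sum_B_add, Pker_translate m ha]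

omit [NeZero s] in
/-- [folklore] The factored kernel `(p, r) ↦ lapRow p (blk r)` is jointly `s·ℤ⁴`-periodic. -/
theorem isPeriodic₂_lapRowKer (ha : 0 < a) (hs : s = (m + 1) * p) : IsPeriodic₂ s (fun p r : X 4 => lapRow m a p (blk m r)) :=
  isPeriodic₂_of_blockCov m (hdiv_of_hs hs) fun t p q => by
    show lapRow m a (p + side m • t) (blk m (q + side m • t)) = lapRow m a p (blk m q)
    rw [blk_translate, lapRow_translate ha]

/-- [folklore] … and has summable rows (block decay of `G′Q′*C` and of `P`). -/
theorem summable_lapRowKer (ha : 0 < a) (p : X 4) : Summable fun r : X 4 => lapRow m a p (blk m r) := by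
  have h1 : Summable fun r : X 4 => kerP m a p (blk m r) :=
    summable_of_blk_majorant m (deltaP_pos 4 ha) (blk m p) fun r => abs_kerP_le m ha p (blk m r)
  have h2 : Summable fun r : X 4 => ∑ q ∈ B m (blk m r), Pker m a p q := by
    refine summable_of_blk_majorant m (C := ((m : ℝ) + 1) ^ 4 * cPP 4 m a) (deltaPP_pos 4 ha) (blk m p) fun r => ?_
    calc |∑ q ∈ B m (blk m r), Pker m a p q| ≤ ∑ q ∈ B m (blk m r), |Pker m a p q| := Finset.abs_sum_le_sum_abs _ _
      _ ≤ ∑ q ∈ B m (blk m r), cPP 4 m a * Real.exp (-(deltaPP 4 a * dist (blk m p) (blk m r))) :=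
          Finset.sum_le_sum fun q hq => by have := abs_Pker_le m ha p q; rwa [mem_B.1 hq] at this
      _ = ((m : ℝ) + 1) ^ 4 * cPP 4 m a * Real.exp (-(deltaPP 4 a * dist (blk m p) (blk m r))) := by
          rw [B6QGQLower276.sum_B_const]; ring
  simpa only [lapRow] using ((h1.mul_left _).sub (h2.mul_left _)).mul_left ((((m : ℝ) + 1) ^ 2)⁻¹)

/-- [folklore] **`P̂·L̂` entrywise** is the periodisation of the factored kernel. -/
theorem Phat_mul_Lhat_apply (ha : 0 < a) (x z : Site 4 s) :
    (Phat m a s * Lhat s) x z = periodise₂ s (fun p r : X 4 => lapRow m a p (blk m r)) x z := by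
  rw [Matrix.mul_apply]
  simp only [Phat_apply, Lhat_apply]
  rw [← periodise₂_compKer (summable_abs_row_Pker m ha) (isPeriodic₂_lapKer s) (rowBound_lapKer m), compKer_Pker_lapKer ha]

/-- [folklore] **`P̂·L̂·λ = 0` FOR BLOCK-MEAN-FREE `λ`** (the torus form of the gauge property of `P`). -/
theorem Phat_Lhat_mulVec (ha : 0 < a) (hs : s = (m + 1) * p) {lam : Site 4 s → ℝ} (hlam : Shat m s *ᵥ lam = 0) : (Phat m a s * Lhat s) *ᵥ lam = 0 := by
  funext x
  simp only [Matrix.mulVec, dotProduct, Pi.zero_apply, Phat_mul_Lhat_apply ha]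
  exact sum_periodise₂_mul_eq_zero_of_blockMeanFree m (isPeriodic₂_lapRowKer ha hs) (summable_lapRowKer ha)
    hs (fun x r r' h => by simp only [h]) ((Shat_mulVec_eq_zero_iff hs lam).1 hlam) x

/-- [folklore] `G′ ∘ 1[same block] = G′Q′*Q′` as kernels. -/
theorem compKer_Gk_sameBlk : compKer (Gk (d := 4) m a) (sameBlk m) = gsKer m a := by
  funext p q
  simp only [compKer, gsKer, gq]
  rw [tsum_eq_sum (s := B m (blk m q)) (fun r hr => by rw [sameBlk, if_neg (fun h => hr (mem_B.2 h)), mul_zero])]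
  exact Finset.sum_congr rfl fun r hr => by rw [sameBlk, if_pos (mem_B.1 hr), mul_one]

/-- [folklore] **`Ĝs = Ĝ′·Ŝ`**. -/
theorem Gshat_eq (ha : 0 < a) (hs : s = (m + 1) * p) : Gshat m a s = Ghat m a s * Shat m s := by
  ext x z
  rw [Matrix.mul_apply]
  simp only [Gshat_apply, Ghat_apply, Shat_apply]
  rw [← periodise₂_compKer (summable_abs_row_Gk m ha) (isPeriodic₂_sameBlk m (hdiv_of_hs hs)) (rowBound_sameBlk m),
    compKer_Gk_sameBlk]

/-- [folklore] `Ĝ′ᵀ = Ĝ′`. -/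
theorem Ghat_transpose (ha : 0 < a) (hs : s = (m + 1) * p) : (Ghat m a s)ᵀ = Ghat m a s := by
  ext x z
  rw [Matrix.transpose_apply, Ghat_apply, Ghat_apply]
  exact (periodise₂_symm (isPeriodic₂_Gk m ha (hdiv_of_hs hs)) (fun p q => Gk_symm m ha p q) x z).symm

/-- [folklore] `Ŝᵀ = Ŝ`. -/
theorem Shat_transpose (hs : s = (m + 1) * p) : (Shat m s)ᵀ = Shat m s := by
  ext x z
  rw [Matrix.transpose_apply, Shat_apply, Shat_apply]
  exact (periodise₂_symm (isPeriodic₂_sameBlk m (hdiv_of_hs hs)) (fun p q => sameBlk_symm m p q) x z).symm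

/-- [folklore] `G′ ∘ Δ′_a = δ` as kernels on `ℤ⁴` (`sum_AX_mul_Gk` + symmetry of both). -/
theorem compKer_Gk_AX (ha : 0 < a) : compKer (Gk (d := 4) m a) (AX m a) = kdelta := by
  funext p q
  simp only [compKer, kdelta]
  have e : ∀ r : X 4, Gk m a p r * AX m a r q = AX m a q r * Gk m a r p := fun r => by
    rw [Gk_symm m ha p r, AX_symm m a r q, mul_comm]
  rw [tsum_congr e, tsum_AX_mul, sum_AX_mul_Gk m ha q p]
  by_cases h : p = q
  · rw [if_pos h, if_pos h.symm]
  · rw [if_neg h, if_neg (Ne.symm h)]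

/-- [folklore] **LEMMA 2.2.2 FOR THE TOWER**: `Ĝ′·ÂX = 1` and `ÂX·Ĝ′ = 1` on the torus. -/
theorem Ghat_mul_AXhat (ha : 0 < a) (hs : s = (m + 1) * p) : Ghat m a s * AXhat m a s = 1 ∧ AXhat m a s * Ghat m a s = 1 := by
  have h := lemma222_periodic (summable_abs_row_Gk m ha) (isPeriodic₂_AX m a (hdiv_of_hs hs)) (rowBound_AX m ha)
    (compKer_Gk_AX ha)
  exact ⟨h.1, h.2⟩

end Identities

/-! ## §3 `1 − P̂` is the orthogonal projector onto the block-mean-free gauge modes `L̂(N̂)` -/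

section Projector

variable {p : ℕ}

/-- [folklore] **`Ĝ′·L̂·λ = (m+1)⁻²·λ`** for block-mean-free `λ` (the periodised tower equation with `Ŝλ = 0`). -/
theorem Ghat_Lhat_mulVec (ha : 0 < a) (hs : s = (m + 1) * p) {lam : Site 4 s → ℝ} (hlam : Shat m s *ᵥ lam = 0) :
    Ghat m a s *ᵥ (Lhat s *ᵥ lam) = (((m : ℝ) + 1) ^ 2)⁻¹ • lam := by
  have h1 := (Ghat_mul_AXhat ha hs).1
  have h2 : Ghat m a s *ᵥ (AXhat m a s *ᵥ lam) = lam := by rw [Matrix.mulVec_mulVec, h1, Matrix.one_mulVec]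
  rw [AXhat_eq, Matrix.add_mulVec, Matrix.smul_mulVec, Matrix.smul_mulVec, hlam, smul_zero, add_zero,
    Matrix.mulVec_smul] at h2
  have hm : (((m : ℝ) + 1) ^ 2) ≠ 0 := by positivity
  calc Ghat m a s *ᵥ (Lhat s *ᵥ lam)
      = (((m : ℝ) + 1) ^ 2)⁻¹ • ((((m : ℝ) + 1) ^ 2) • (Ghat m a s *ᵥ (Lhat s *ᵥ lam))) := by
        rw [smul_smul, inv_mul_cancel₀ hm, one_smul]
    _ = (((m : ℝ) + 1) ^ 2)⁻¹ • lam := by rw [h2]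

/-- [folklore] **`(m+1)²·L̂·Ĝ′·w = w`** whenever `Ŝ·Ĝ′·w = 0`. -/
theorem Lhat_Ghat_mulVec (ha : 0 < a) (hs : s = (m + 1) * p) {w : Site 4 s → ℝ} (hw : Shat m s *ᵥ (Ghat m a s *ᵥ w) = 0) :
    (((m : ℝ) + 1) ^ 2) • (Lhat s *ᵥ (Ghat m a s *ᵥ w)) = w := by
  have h1 := (Ghat_mul_AXhat ha hs).2
  have h2 : AXhat m a s *ᵥ (Ghat m a s *ᵥ w) = w := by rw [Matrix.mulVec_mulVec, h1, Matrix.one_mulVec]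
  rwa [AXhat_eq, Matrix.add_mulVec, Matrix.smul_mulVec, Matrix.smul_mulVec, hw, smul_zero, add_zero] at h2

/-- [folklore] `Ĝsᵀ = Ŝ·Ĝ′`. -/
theorem Gshat_transpose (ha : 0 < a) (hs : s = (m + 1) * p) : (Gshat m a s)ᵀ = Shat m s * Ghat m a s := by
  rw [Gshat_eq ha hs, Matrix.transpose_mul, Ghat_transpose ha hs, Shat_transpose hs]

/-- [folklore] **`Ŝ·Ĝ′·(1 − P̂) = 0`** (`= ((1 − P̂)·Ĝs)ᵀ` and `P̂Ĝs = Ĝs`). -/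
theorem Shat_Ghat_Rhat (ha : 0 < a) (hs : s = (m + 1) * p) : Shat m s * Ghat m a s * (1 - Phat m a s) = 0 := by
  rw [← Gshat_transpose ha hs]
  have h : (1 - Phat m a s) * Gshat m a s = 0 := by rw [Matrix.sub_mul, Matrix.one_mul, Phat_mul_Gshat ha hs, sub_self]
  have ht := congrArg Matrix.transpose h
  rw [Matrix.transpose_mul, Matrix.transpose_sub, Matrix.transpose_one, Phat_transpose ha hs, Matrix.transpose_zero] at ht
  exact ht

/-- [folklore] **EVERY `(1 − P̂)v` IS A BLOCK-MEAN-FREE GAUGE MODE**: with `λ := (m+1)²·Ĝ′(1 − P̂)v`, `Ŝλ = 0` and `(1 − P̂)v = L̂λ`. -/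
theorem Rhat_mulVec_eq_Lhat (ha : 0 < a) (hs : s = (m + 1) * p) (v : Site 4 s → ℝ) :
    Shat m s *ᵥ ((((m : ℝ) + 1) ^ 2) • (Ghat m a s *ᵥ ((1 - Phat m a s) *ᵥ v))) = 0 ∧
      (1 - Phat m a s) *ᵥ v = Lhat s *ᵥ ((((m : ℝ) + 1) ^ 2) • (Ghat m a s *ᵥ ((1 - Phat m a s) *ᵥ v))) := by
  have h0 : Shat m s *ᵥ (Ghat m a s *ᵥ ((1 - Phat m a s) *ᵥ v)) = 0 := by
    rw [Matrix.mulVec_mulVec, Matrix.mulVec_mulVec, Shat_Ghat_Rhat ha hs, Matrix.zero_mulVec]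
  refine ⟨by rw [Matrix.mulVec_smul, h0, smul_zero], ?_⟩
  rw [Matrix.mulVec_smul]
  exact (Lhat_Ghat_mulVec ha hs h0).symm

/-- [folklore] **`(1 − P̂)` FIXES the block-mean-free gauge modes**: `(1 − P̂)(L̂λ) = L̂λ` when `Ŝλ = 0`. -/
theorem Rhat_Lhat_mulVec (ha : 0 < a) (hs : s = (m + 1) * p) {lam : Site 4 s → ℝ} (hlam : Shat m s *ᵥ lam = 0) :
    (1 - Phat m a s) *ᵥ (Lhat s *ᵥ lam) = Lhat s *ᵥ lam := by
  rw [Matrix.sub_mulVec, Matrix.one_mulVec, Matrix.mulVec_mulVec, Phat_Lhat_mulVec ha hs hlam, sub_zero]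

/-- [folklore] **`(1 − P̂)·Ĝs = 0`** — `1 − P̂` kills the range of `Ĝ′Q̂′*`. -/
theorem Rhat_mul_Gshat (ha : 0 < a) (hs : s = (m + 1) * p) : (1 - Phat m a s) * Gshat m a s = 0 := by
  rw [Matrix.sub_mul, Matrix.one_mul, Phat_mul_Gshat ha hs, sub_self]

/-- [folklore] `(1 − P̂)² = 1 − P̂`. -/
theorem Rhat_mul_Rhat (ha : 0 < a) (hs : s = (m + 1) * p) : (1 - Phat m a s) * (1 - Phat m a s) = 1 - Phat m a s := by
  rw [Matrix.sub_mul, Matrix.one_mul, Matrix.mul_sub, Matrix.mul_one, Phat_mul_Phat ha hs, sub_self, sub_zero]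

/-- [folklore] `(1 − P̂)ᵀ = 1 − P̂`. -/
theorem Rhat_transpose (ha : 0 < a) (hs : s = (m + 1) * p) : (1 - Phat m a s)ᵀ = 1 - Phat m a s := by
  rw [Matrix.transpose_sub, Matrix.transpose_one, Phat_transpose ha hs]

/-- [folklore] **ORTHOGONALITY `⟨Ĝs ω, L̂λ⟩ = 0`** for block-mean-free `λ`: `range(Ĝ′Q̂′*) ⊥ L̂(N̂)`. -/
theorem Gshat_mulVec_dot_Lhat_mulVec (ha : 0 < a) (hs : s = (m + 1) * p) (ω : Site 4 s → ℝ) {lam : Site 4 s → ℝ} (hlam : Shat m s *ᵥ lam = 0) :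
    (Gshat m a s *ᵥ ω) ⬝ᵥ (Lhat s *ᵥ lam) = 0 := by
  have e1 : (Gshat m a s *ᵥ ω) ⬝ᵥ (Lhat s *ᵥ lam) = ω ⬝ᵥ ((Gshat m a s)ᵀ *ᵥ (Lhat s *ᵥ lam)) := by
    conv_rhs => rw [Matrix.dotProduct_mulVec, Matrix.vecMul_transpose]
  rw [e1, Gshat_transpose ha hs, ← Matrix.mulVec_mulVec, Ghat_Lhat_mulVec ha hs hlam, Matrix.mulVec_smul, hlam,
    smul_zero, dotProduct_zero]

/-- [folklore] **`1 − P̂` IS THE ORTHOGONAL PROJECTOR ONTO `L̂(N̂)`**, as a characterisation of its fixed vectors: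
`(1 − P̂)v = v ↔ v = L̂λ` for some block-mean-free `λ` (with `Rhat_mul_Rhat`, `Rhat_transpose` this pins `1 − P̂` down). -/
theorem Rhat_mulVec_eq_self_iff (ha : 0 < a) (hs : s = (m + 1) * p) (v : Site 4 s → ℝ) :
    (1 - Phat m a s) *ᵥ v = v ↔ ∃ lam : Site 4 s → ℝ, Shat m s *ᵥ lam = 0 ∧ v = Lhat s *ᵥ lam := by
  constructor
  · intro h
    obtain ⟨h1, h2⟩ := Rhat_mulVec_eq_Lhat ha hs v
    exact ⟨_, h1, by rw [← h2, h]⟩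
  · rintro ⟨lam, hlam, rfl⟩
    exact Rhat_Lhat_mulVec ha hs hlam

end Projector

end

end Summit.QuantumFields.BalabanUV.Beta.D1BFx.PeriodisedProjector
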